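import Mathlib
import Summits.ValiantsHypothesis.ValiantsHypothesis.Theorems.GrenetZeonTwoDimCoefficientsScalingIndexHessianRate
import Summits.ValiantsHypothesis.ValiantsHypothesis.Theorems.GrenetZeonTwoDimCoefficientsScalingLinearSubstitution

/-!
# Crux `GrenetZeon.TwoDimCoefficients` (stmt-ValiantsHypothesis-8062), stub `stub_dualUnipotent`:
# scaling-closure — the 3/2 rung MODULO A PER-GENERIC INDEX-REDUCING SUBSTITUTION (bricks T2 + T3 of memo EIGHTEENTH-HAND.md §R6)

The residual R6 of the rung `n³ ≤ C·m²` (decl `DualUnipotentThreeHalves`, stmt-24318) is the class of unipotent pencils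
`A = A₀(1 − N)` whose (nilpotent) linear part `N` has nil-index `> n`.  This file turns the per-free Hessian-rate law
(✓ `rank_hess0_top_mul_le_of_index`, p835784) and the substitution bookkeeping (✓ `rank_hess0_transl_le_of_linSubst`) into
the CONDITIONAL BRIDGE of the memo: a unipotent dual representation of `per_n` of width `m` together with a linear
substitution `T` of the `n²` variables such that `N ∘ T` has nil-index `≤ n` satisfies

  `ρ · n ≤ 2m² + 2(n² − rank T)·n`   for the Hessian rank `ρ` of `per_n` at any point of the form `T w`.

So an index-reducing substitution of corank `κ` through a point of Hessian rank `n² − κ′` gives `(n² − κ′ − 2κ)·n ≤ 2m²`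
(both hypotheses are needed: König subspaces of corank `n` kill `per_n`).  No nilpotency-index hypothesis on `N` itself.

* `isAffine_map_linSubst`, `homogeneousComponent_bind₁_linSubst` — substitution bookkeeping (T2);
* ★★ `rank_hess0_perPoly_mul_le_of_indexReducingSubst` — the bridge (T3).

HONEST FRAMING: a conditional reduction; the existence of a per-generic index-reducing substitution for WILD nilpotent spaces
of nil-index `> n` (memo T4) is open, as are the stub `DualUnipotentBound`, crux 8062, the 24318 decl and `VP ≠ VNP`.

References: T. Mignon, N. Ressayre, Int. Math. Res. Not. 2004:79, Thm. 1.1 (via the tree); folklore.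
-/

-- single-conjunct layout `Summits/ValiantsHypothesis/ValiantsHypothesis`: the duplicated namespace
-- component is mandated by the tree.
set_option linter.dupNamespace false
set_option autoImplicit false

noncomputable section

namespace Summit.ValiantsHypothesis.ValiantsHypothesis.Theorems.GrenetZeonTwoDimCoefficients.ScalingClosure

open MvPolynomial Matrix
open Literature.Computability.AlgebraicComplexity
open Literature.Algebra.Polynomial
open Summit.ValiantsHypothesis.ValiantsHypothesis.Cruxes.TwoDimCoefficients.DimTwoCases

/-! ### T2: substitution bookkeeping -/

section Bookkeeping

variable {σ : Type*} [Fintype σ]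

/-- A linear substitution commutes with taking homogeneous components. [folklore] -/
theorem homogeneousComponent_bind₁_linSubst (T : Matrix σ σ ℂ) (p : MvPolynomial σ ℂ) (d : ℕ) :
    homogeneousComponent d (bind₁ (linSubst T) p) = bind₁ (linSubst T) (homogeneousComponent d p) := by
  conv_lhs => rw [← sum_homogeneousComponent p]
  rw [map_sum, map_sum, Finset.sum_eq_single d]
  · rw [homogeneousComponent_of_mem
      (isHomogeneous_bind₁_linSubst T (homogeneousComponent_isHomogeneous d p)), if_pos rfl]
  · intro b _ hb
    rw [homogeneousComponent_of_mem
      (isHomogeneous_bind₁_linSubst T (homogeneousComponent_isHomogeneous b p)), if_neg (fun h => hb h.symm)]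
  · intro hd
    rw [Finset.mem_range, not_lt] at hd
    rw [homogeneousComponent_eq_zero d p (by omega), map_zero, map_zero]

/-- A linear substitution does not raise the total degree. [folklore] -/
theorem totalDegree_bind₁_linSubst_le (T : Matrix σ σ ℂ) (p : MvPolynomial σ ℂ) :
    (bind₁ (linSubst T) p).totalDegree ≤ p.totalDegree := by
  conv_lhs => rw [← sum_homogeneousComponent p]
  rw [map_sum]
  refine (totalDegree_finsetSum _ _).trans (Finset.sup_le fun d hd => ?_)
  rw [Finset.mem_range] at hd
  exact (isHomogeneous_bind₁_linSubst T (homogeneousComponent_isHomogeneous d p)).totalDegree_le.trans (by omega)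

/-- Substituting linear forms into an affine matrix gives an affine matrix. [folklore] -/
theorem isAffine_map_linSubst {n m : ℕ} (T : Matrix (Fin n × Fin n) (Fin n × Fin n) ℂ) (M : AffMat n m)
    (hM : IsAffine M) : IsAffine (M.map (bind₁ (linSubst T))) := fun i j => by
  rw [Matrix.map_apply]
  exact (totalDegree_bind₁_linSubst_le T (M i j)).trans (hM i j)

/-- The trace commutes with an entrywise ring map. [folklore] -/
theorem trace_map_bind₁ {ι : Type*} [Fintype ι] (T : Matrix σ σ ℂ) (M : Matrix ι ι (MvPolynomial σ ℂ)) :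
    (M.map (bind₁ (linSubst T))).trace = bind₁ (linSubst T) M.trace := by
  simp only [Matrix.trace, Matrix.diag_apply, Matrix.map_apply, map_sum]

end Bookkeeping


/-! ### T3: the conditional bridge -/

section Bridge

/-- ★★ **The 3/2 rung modulo a per-generic index-reducing substitution.**  Let `per_n = α·c + β·tr(adj A·B)` be a
unipotent dual representation of width `m` (`A = A₀(1 − N)`, `N` linear — of ANY nil-index — `A₀P₀ = 1`, `det A = c ≠ 0`,
`β ≠ 0`, `n ≥ 2`), and let `T` be a linear substitution of the `n²` variables such that `(N ∘ T)ⁿ = 0`.  Then for every `w`,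
`rank Hess per_n (T w) · n ≤ 2m² + 2(n² − rank T)·n`. [cite: MignonRessayre2004, Thm. 1.1 — via the tree; folklore] -/
theorem rank_hess0_perPoly_mul_le_of_indexReducingSubst {n m : ℕ} (hn : 2 ≤ n) (A B : AffMat n m) (hA : IsAffine A)
    (hB : IsAffine B) (α β c : ℂ) (hc : c ≠ 0) (hβ : β ≠ 0) (hdet : A.det = MvPolynomial.C c)
    (hper : perPoly (Fin n) ℂ = MvPolynomial.C α * A.det + MvPolynomial.C β * (A.adjugate * B).trace)
    (A₀ P₀ : Matrix (Fin m) (Fin m) ℂ) (hP₀ : A₀ * P₀ = 1) (N : AffMat n m)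
    (hN : ∀ i j, (N i j).IsHomogeneous 1) (hAN : A = A₀.map MvPolynomial.C * (1 - N))
    (T : Matrix (Fin n × Fin n) (Fin n × Fin n) ℂ) (hTn : (N.map (bind₁ (linSubst T))) ^ n = 0)
    (w : Fin n × Fin n → ℂ) :
    (hess0 (transl (T.mulVec w) (perPoly (Fin n) ℂ))).rank * n ≤ 2 * m ^ 2 + 2 * (n ^ 2 - T.rank) * n := by
  classical
  set φ : MvPolynomial (Fin n × Fin n) ℂ →ₐ[ℂ] MvPolynomial (Fin n × Fin n) ℂ := bind₁ (linSubst T) with hφ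
  have hu : IsUnit A.det := by rw [hdet]; exact (isUnit_iff_ne_zero.mpr hc).map MvPolynomial.C
  -- the substituted pencil
  set A' : AffMat n m := A.map φ with hA'
  set B' : AffMat n m := B.map φ with hB'
  set N' : AffMat n m := N.map φ with hN'
  have hA'aff : IsAffine A' := isAffine_map_linSubst T A hA
  have hB'aff : IsAffine B' := isAffine_map_linSubst T B hB
  have hN'hom : ∀ i j, (N' i j).IsHomogeneous 1 := fun i j => by
    rw [hN', Matrix.map_apply]; exact isHomogeneous_bind₁_linSubst T (hN i j)
  have hφC : ∀ a : ℂ, φ (MvPolynomial.C a) = MvPolynomial.C a := fun a => bind₁_C_right _ _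
  have hA'N : A' = A₀.map MvPolynomial.C * (1 - N') := by
    rw [hA', hAN, Matrix.map_mul, Matrix.map_sub _ (map_sub φ), Matrix.map_one _ (map_zero φ) (map_one φ), hN']
    congr 1
    apply Matrix.ext; intro i j
    simp only [Matrix.map_apply, hφC]
  have hdet' : A'.det = MvPolynomial.C c := by
    rw [hA', ← AlgHom.mapMatrix_apply, ← AlgHom.map_det, hdet, hφC]
  -- its top numerator is the substituted top numerator
  have htop : homogeneousComponent n ((A'.adjugate * B').trace) =
      MvPolynomial.C β⁻¹ * φ (perPoly (Fin n) ℂ) := by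
    have hadj : A'.adjugate = A.adjugate.map φ := by
      rw [hA', ← AlgHom.mapMatrix_apply, ← AlgHom.mapMatrix_apply, AlgHom.map_adjugate]
    rw [hadj, hB', ← Matrix.map_mul, trace_map_bind₁, homogeneousComponent_bind₁_linSubst, ← coeff_det_one A B hu,
      homogeneousComponent_coeff_det_one (by omega) A B α β c hc hβ hdet hper, map_mul, hφC]
  -- the per-free law on the substituted (index-`n`) pencil
  have hlaw := rank_hess0_top_mul_le_of_index hn A' B' hA'aff hB'aff c hc hdet' A₀ P₀ hP₀ N' hN'hom hTn hA'N w
  rw [htop, map_mul, transl_C, hess0_C_mul, rank_smul_eq (inv_ne_zero hβ)] at hlaw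
  -- the substitution loses at most `2 (n² - rank T)`
  have hsub := rank_hess0_transl_le_of_linSubst T (perPoly (Fin n) ℂ) w
  rw [Fintype.card_prod, Fintype.card_fin, ← sq] at hsub
  calc (hess0 (transl (T.mulVec w) (perPoly (Fin n) ℂ))).rank * n
      ≤ ((hess0 (transl w (bind₁ (linSubst T) (perPoly (Fin n) ℂ)))).rank + 2 * (n ^ 2 - T.rank)) * n :=
        Nat.mul_le_mul_right _ hsub
    _ = (hess0 (transl w (φ (perPoly (Fin n) ℂ)))).rank * n + 2 * (n ^ 2 - T.rank) * n := by rw [hφ, add_mul]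
    _ ≤ 2 * m ^ 2 + 2 * (n ^ 2 - T.rank) * n := Nat.add_le_add_right hlaw _

/-- ★★ **Corollary (the bridge in the memo's form).**  An index-reducing substitution of corank `≤ κ` through a point of
Hessian rank `≥ n² − κ′` gives `(n² − κ′ − 2κ)·n ≤ 2m²`. [cite: MignonRessayre2004, Thm. 1.1 — via the tree; folklore] -/
theorem sq_sub_mul_le_of_indexReducingSubst {n m : ℕ} (hn : 2 ≤ n) (A B : AffMat n m) (hA : IsAffine A)
    (hB : IsAffine B) (α β c : ℂ) (hc : c ≠ 0) (hβ : β ≠ 0) (hdet : A.det = MvPolynomial.C c)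
    (hper : perPoly (Fin n) ℂ = MvPolynomial.C α * A.det + MvPolynomial.C β * (A.adjugate * B).trace)
    (A₀ P₀ : Matrix (Fin m) (Fin m) ℂ) (hP₀ : A₀ * P₀ = 1) (N : AffMat n m)
    (hN : ∀ i j, (N i j).IsHomogeneous 1) (hAN : A = A₀.map MvPolynomial.C * (1 - N))
    (T : Matrix (Fin n × Fin n) (Fin n × Fin n) ℂ) (hTn : (N.map (bind₁ (linSubst T))) ^ n = 0)
    {κ κ' : ℕ} (hκ : n ^ 2 ≤ T.rank + κ) (w : Fin n × Fin n → ℂ)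
    (hκ' : n ^ 2 ≤ (hess0 (transl (T.mulVec w) (perPoly (Fin n) ℂ))).rank + κ') :
    (n ^ 2 - κ' - 2 * κ) * n ≤ 2 * m ^ 2 := by
  have h := rank_hess0_perPoly_mul_le_of_indexReducingSubst hn A B hA hB α β c hc hβ hdet hper A₀ P₀ hP₀ N hN hAN T
    hTn w
  have h1 : n ^ 2 - T.rank ≤ κ := by omega
  by_cases hcase : κ' + 2 * κ ≤ n ^ 2
  · have h2 : (n ^ 2 - κ' - 2 * κ) * n + 2 * (n ^ 2 - T.rank) * n ≤
        (hess0 (transl (T.mulVec w) (perPoly (Fin n) ℂ))).rank * n := by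
      rw [← add_mul]
      apply Nat.mul_le_mul_right
      omega
    omega
  · have h0 : n ^ 2 - κ' - 2 * κ = 0 := by omega
    rw [h0, zero_mul]
    exact Nat.zero_le _

end Bridge


/-! ### T3′: the per-free bridge (appended) -/

section BridgePerFree

/-- ★★ **Per-free bridge.**  For a unipotent pencil `A = A₀(1 − N)` (`N` linear of ANY nil-index, `A₀P₀ = 1`,
`det A = c ≠ 0`, `n ≥ 2`), any affine `B` with top numerator `p = [tr(adj A·B)]_n`, and a linear substitution `T` of the
`n²` variables with `(N ∘ T)ⁿ = 0`: `rank Hess p (T w) · n ≤ 2m² + 2(n² − rank T)·n` for every `w` — the form needed when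
the target is not `per_n` itself (minors, gauged numerators). [cite: MignonRessayre2004, Thm. 1.1 — via the tree; folklore] -/
theorem rank_hess0_top_mul_le_of_indexReducingSubst {n m : ℕ} (hn : 2 ≤ n) (A B : AffMat n m) (hA : IsAffine A)
    (hB : IsAffine B) (c : ℂ) (hc : c ≠ 0) (hdet : A.det = MvPolynomial.C c)
    (A₀ P₀ : Matrix (Fin m) (Fin m) ℂ) (hP₀ : A₀ * P₀ = 1) (N : AffMat n m)
    (hN : ∀ i j, (N i j).IsHomogeneous 1) (hAN : A = A₀.map MvPolynomial.C * (1 - N))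
    (T : Matrix (Fin n × Fin n) (Fin n × Fin n) ℂ) (hTn : (N.map (bind₁ (linSubst T))) ^ n = 0)
    (w : Fin n × Fin n → ℂ) :
    (hess0 (transl (T.mulVec w) (homogeneousComponent n ((A.adjugate * B).trace)))).rank * n ≤
      2 * m ^ 2 + 2 * (n ^ 2 - T.rank) * n := by
  classical
  set φ : MvPolynomial (Fin n × Fin n) ℂ →ₐ[ℂ] MvPolynomial (Fin n × Fin n) ℂ := bind₁ (linSubst T) with hφ
  set p : MvPolynomial (Fin n × Fin n) ℂ := homogeneousComponent n ((A.adjugate * B).trace) with hp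
  -- the substituted pencil
  set A' : AffMat n m := A.map φ with hA'
  set B' : AffMat n m := B.map φ with hB'
  set N' : AffMat n m := N.map φ with hN'
  have hA'aff : IsAffine A' := isAffine_map_linSubst T A hA
  have hB'aff : IsAffine B' := isAffine_map_linSubst T B hB
  have hN'hom : ∀ i j, (N' i j).IsHomogeneous 1 := fun i j => by
    rw [hN', Matrix.map_apply]; exact isHomogeneous_bind₁_linSubst T (hN i j)
  have hφC : ∀ a : ℂ, φ (MvPolynomial.C a) = MvPolynomial.C a := fun a => bind₁_C_right _ _
  have hA'N : A' = A₀.map MvPolynomial.C * (1 - N') := by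
    rw [hA', hAN, Matrix.map_mul, Matrix.map_sub _ (map_sub φ), Matrix.map_one _ (map_zero φ) (map_one φ), hN']
    congr 1
    apply Matrix.ext; intro i j
    simp only [Matrix.map_apply, hφC]
  have hdet' : A'.det = MvPolynomial.C c := by
    rw [hA', ← AlgHom.mapMatrix_apply, ← AlgHom.map_det, hdet, hφC]
  -- its top numerator is the substituted top numerator
  have htop : homogeneousComponent n ((A'.adjugate * B').trace) = φ p := by
    have hadj : A'.adjugate = A.adjugate.map φ := by
      rw [hA', ← AlgHom.mapMatrix_apply, ← AlgHom.mapMatrix_apply, AlgHom.map_adjugate]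
    rw [hadj, hB', ← Matrix.map_mul, trace_map_bind₁, homogeneousComponent_bind₁_linSubst]
  -- the per-free law on the substituted (index-`n`) pencil and the substitution loss
  have hlaw := rank_hess0_top_mul_le_of_index hn A' B' hA'aff hB'aff c hc hdet' A₀ P₀ hP₀ N' hN'hom hTn hA'N w
  rw [htop] at hlaw
  have hsub := rank_hess0_transl_le_of_linSubst T p w
  rw [Fintype.card_prod, Fintype.card_fin, ← sq] at hsub
  calc (hess0 (transl (T.mulVec w) p)).rank * n
      ≤ ((hess0 (transl w (bind₁ (linSubst T) p))).rank + 2 * (n ^ 2 - T.rank)) * n := Nat.mul_le_mul_right _ hsub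
    _ = (hess0 (transl w (φ p))).rank * n + 2 * (n ^ 2 - T.rank) * n := by rw [hφ, add_mul]
    _ ≤ 2 * m ^ 2 + 2 * (n ^ 2 - T.rank) * n := Nat.add_le_add_right hlaw _

end BridgePerFree

end Summit.ValiantsHypothesis.ValiantsHypothesis.Theorems.GrenetZeonTwoDimCoefficients.ScalingClosure

end
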